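import Summits.CriticalPhenomena.CardyFormulaZ2.Theorems.CardySelfDualSegmentUniformBoxCrossingDefs
import Literature.Probability.Percolation.FourArmGarbanTwoArms
import HarnessLib

/-!
# Stub `stub_smallGap` (crux stmt-CriticalPhenomena-5476 `UniformBoxCrossing`, line `Sketch`),
# part 1: stacked squares — vertical translates, frame identities, monotonicity of the regions

Bollobás–Riordan, *Percolation on self-dual polygon configurations* (2010, arXiv:1001.4674),
§5.1, Lemma 5.6, for the corner models `M_t = cornerPercolation t`: the DETERMINISTIC geometry of
a stack of squares `S_i = [0, n]² + (0, h_i)`, all explored in the vocabulary of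
`…UniformBoxCrossingDefs.lean` (which only knows the two squares `[0, n]²` and `[0, n]² + (0, s)`)
by translating the configuration DOWN: `shiftDown h ω` is `ω - (0, h)`, so that exploring
`[0, n]²` in `shiftDown h ω` explores `[0, n] × [h, h + n]` in `ω`.

* `shiftDown` and its bookkeeping (`mem_shiftDown_iff`, `shiftDown_shiftDown`,
  lattice-ness, duality commutes with translation (`FourArmGarbanTwoArms.lean`),
  `mem_upperLR_iff` : `H([0,n]² + (0,s))` for `ω` is `H([0,n]²)` for `shiftDown s ω`).
* FRAME IDENTITY `mem_upperRegion_iff_shiftDown`: the upper region of the square `[0,n]² + (0,s)`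
  (shift parameter `s`) is the upper region of `[0, n]²` (shift parameter `0`) of the configuration
  translated down by `s`, translated back (`reflConfig n 0 (shiftDown s ω) = reflConfig n s ω`).
* MONOTONICITY of the exploration from below in the height of the square (the canonical-hull
  design of `lowerHull` makes this true): for `d ≥ 0`, faces explored from below / hull faces /
  points of the lower region of `[0, n]²` at rows `≥ d - 1` are, translated by `-(0, d)`, explored
  from below / hull faces / points of the lower region of `[0, n]²` for `shiftDown d ω` — i.e. in
  absolute coordinates `A(S + (0, h)) ⊆ A(S + (0, h'))` for `h ≤ h'`
  (`sub_mem_dualBelow_shiftDown`, `sub_mem_lowerHull_shiftDown`, `sub_mem_lowerRegion_shiftDown`).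

Part 2 (`…StubSmallGapPart2.lean`) does the disjointness-of-gaps / pigeonhole step of Lemma 5.6,
the stub file (`…StubSmallGap.lean`) the probabilistic wrapper.
-/

noncomputable section

namespace Summit.CriticalPhenomena.CardyFormulaZ2.Cruxes.UniformBoxCrossing.NonSlantLine

open SimpleGraph Finset Literature.Probability.Percolation Literature.Probability.LatticeModels

/-! ### Vertical translates of a configuration -/

section Shift

/-- The configuration `ω` translated DOWN by `h`: the lattice edge `e` is open in `shiftDown h ω`
iff `e + (0, h)` is open in `ω` (literally `BondConfig.relabel` along the translation by
`-(0, h)`, the form in which `CoverStatement` is stated). [folklore] -/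
def shiftDown (h : ℕ) (ω : BondConfig (Site 2)) : BondConfig (Site 2) :=
  BondConfig.relabel (sym2Equiv (Site.shift (-![0, (h : ℤ)]))) ω

/-- `shiftDown h` is the relabelling along the translation by `-(0, h)`. [folklore] -/
theorem shiftDown_eq (h : ℕ) :
    shiftDown h = ⇑(BondConfig.relabel (sym2Equiv (Site.shift (-![0, (h : ℤ)])))) := rfl

/-- The inverse of the translation by `-v` is the translation by `v`, as a map. [folklore] -/
theorem coe_shift_neg_symm (v : Site 2) : (⇑(Site.shift (-v)).symm : Site 2 → Site 2) = ⇑(Site.shift v) := by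
  funext x
  simp [sub_neg_eq_add]

/-- Membership in the translated configuration. [folklore] -/
theorem mem_shiftDown_iff (h : ℕ) (ω : BondConfig (Site 2)) (e : Sym2 (Site 2)) :
    e ∈ shiftDown h ω ↔ Sym2.map (Site.shift ![0, (h : ℤ)]) e ∈ ω := by
  rw [shiftDown, BondConfig.mem_relabel_iff, sym2Equiv_symm, sym2Equiv_apply, coe_shift_neg_symm]

/-- Translating down by `b` and then by `a` is translating down by `a + b`. [folklore] -/
theorem shiftDown_shiftDown (a b : ℕ) (ω : BondConfig (Site 2)) :
    shiftDown a (shiftDown b ω) = shiftDown (a + b) ω := by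
  ext e
  rw [mem_shiftDown_iff, mem_shiftDown_iff, mem_shiftDown_iff, Sym2.map_map]
  have : (⇑(Site.shift ![0, (b : ℤ)]) ∘ ⇑(Site.shift ![0, (a : ℤ)]) : Site 2 → Site 2) =
      ⇑(Site.shift ![0, ((a + b : ℕ) : ℤ)]) := by
    funext x
    rw [Function.comp_apply, Site.eq_iff_two]
    simp only [Site.shift_apply, Pi.add_apply, Matrix.cons_val_zero, Matrix.cons_val_one,
      Matrix.cons_val_fin_one, Nat.cast_add]
    constructor <;> ring
  rw [this]

/-- Translates of lattice configurations are lattice configurations. [folklore] -/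
theorem shiftDown_subset_edgeSet (h : ℕ) {ω : BondConfig (Site 2)} (hω : ω ⊆ (zdGraph 2).edgeSet) :
    shiftDown h ω ⊆ (zdGraph 2).edgeSet :=
  relabel_subset_edgeSet (zdShiftIso (-![0, (h : ℤ)])) hω

/-- **The dual configuration of a translate is the translate of the dual configuration**
(`map_shift_mem_dualConfig_relabel_iff` of `FourArmGarbanTwoArms.lean`, membership form for
`shiftDown`): `e - (0, d)` is dual-open for `shiftDown d ω` iff `e` is dual-open for `ω`. [folklore] -/
theorem map_shift_mem_dualConfig_shiftDown_iff (d : ℕ) (ω : BondConfig (Site 2)) (e : Sym2 (Site 2)) :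
    Sym2.map (Site.shift (-![0, (d : ℤ)])) e ∈ dualConfig (shiftDown d ω) ↔ e ∈ dualConfig ω :=
  map_shift_mem_dualConfig_relabel_iff _ ω e

/-- Translating back: `(· - v) '' ((· + v) '' U) = U`. [folklore] -/
theorem image_shift_neg_image_add (v : Site 2) (U : Set (Site 2)) :
    ⇑(Site.shift (-v)) '' ((· + v) '' U) = U := by
  rw [Set.image_image]
  convert Set.image_id U using 2
  simp

/-- **`H(S₂)` is `H(S₁)` for the configuration translated down**: `ω` has an open left–right
crossing of `[0, n]² + (0, s)` iff `shiftDown s ω` has one of `[0, n]²`. [folklore] -/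
theorem mem_upperLR_iff {n s : ℕ} {ω : BondConfig (Site 2)} :
    ω ∈ upperLR n s ↔ shiftDown s ω ∈ lrCrossing n n := by
  have h := preimage_relabel_openCrossing (Site.shift (-![0, (s : ℤ)]))
    ((· + ![0, (s : ℤ)]) '' (↑(rectangle n n) : Set (Site 2)))
    ((· + ![0, (s : ℤ)]) '' ↑(leftSide n n)) ((· + ![0, (s : ℤ)]) '' ↑(rightSide n n))
  rw [image_shift_neg_image_add, image_shift_neg_image_add, image_shift_neg_image_add] at h
  exact (Set.ext_iff.1 h ω).symm

end Shift

/-! ### The frame identity for the upper region -/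

section Frame

variable (n s : ℕ)

/-- Reflecting `[0, n]²` after translating down by `s` is reflecting in the axis of
`[0, n]² + (0, s)`: `reflY n ∘ (· - (0, s)) = reflY (n + s)`. [folklore] -/
theorem upperRefl_zero_sub (v : Site 2) : upperRefl n 0 (v - ![0, (s : ℤ)]) = upperRefl n s v := by
  rw [Site.eq_iff_two]
  simp only [upperRefl_apply_zero, upperRefl_apply_one, Pi.sub_apply, Matrix.cons_val_zero,
    Matrix.cons_val_one, Matrix.cons_val_fin_one, Nat.cast_zero]
  constructor <;> ring

/-- The reflected configurations agree: `reflConfig n 0 (shiftDown s ω) = reflConfig n s ω` (both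
are `ω` reflected in the horizontal axis of the square `[0, n]² + (0, s)`, in the frame in which
that square becomes `[0, n]²`). [folklore] -/
theorem reflConfig_zero_shiftDown (ω : BondConfig (Site 2)) :
    reflConfig n 0 (shiftDown s ω) = reflConfig n s ω := by
  ext e
  rw [mem_reflConfig_iff, mem_shiftDown_iff, mem_reflConfig_iff, Sym2.map_map]
  have : (⇑(Site.shift ![0, (s : ℤ)]) ∘ ⇑(upperRefl n 0) : Site 2 → Site 2) = ⇑(upperRefl n s) := by
    funext x
    rw [Function.comp_apply, Site.eq_iff_two]
    simp only [Site.shift_apply, Pi.add_apply, upperRefl_apply_zero, upperRefl_apply_one,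
      Matrix.cons_val_zero, Matrix.cons_val_one, Matrix.cons_val_fin_one, Nat.cast_zero]
    constructor <;> ring
  rw [this]

/-- **Frame identity.** The upper region of `S₂ = [0, n]² + (0, s)` (B–R's `B`, "on or above
`UH(S₂)`") is the translate by `(0, s)` of the upper region, with shift parameter `0`, of the
configuration translated down by `s`. [folklore] -/
theorem mem_upperRegion_iff_shiftDown {ω : BondConfig (Site 2)} {v : Site 2} :
    v ∈ upperRegion n s ω ↔ v - ![0, (s : ℤ)] ∈ upperRegion n 0 (shiftDown s ω) := by
  rw [mem_upperRegion_iff, mem_upperRegion_iff, reflConfig_zero_shiftDown, upperRefl_zero_sub]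

end Frame

/-! ### Monotonicity of the exploration from below in the height of the square -/

section Monotone

variable {n d : ℕ} {ω : BondConfig (Site 2)}

/-- A lattice walk starting at height `≥ c` none of whose step sources lies at height `c` stays at
height `≥ c`. [folklore] -/
private theorem apply_ge_of_darts'' {x y : Site 2} (p : (zdGraph 2).Walk x y) (i : Fin 2) (c : ℤ)
    (hx : c ≤ x i) (h : ∀ e ∈ p.darts, e.fst i ≠ c) : ∀ z ∈ p.support, c ≤ z i := by
  -- adapted from `apply_ge_of_darts` (…StubBRChainPart1.lean)
  induction p with
  | nil => intro z hz; rw [Walk.support_nil, List.mem_singleton] at hz; rw [hz]; exact hx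
  | cons hadj p ih =>
    rename_i x w y
    have hxc : x i ≠ c := h ⟨(x, w), hadj⟩ (by simp)
    have hw : c ≤ w i := by have := (zdGraph_adj_apply_le hadj i).2; omega
    intro z hz
    rw [Walk.support_cons, List.mem_cons] at hz
    rcases hz with rfl | hz
    · exact hx
    · exact ih hw (fun e he => h e (by simp [he])) z hz

/-- Coordinates of `v - (0, d)`. [folklore] -/
@[simp] theorem sub_vec_apply_zero (v : Site 2) (c : ℤ) : (v - ![0, c]) 0 = v 0 := by simp

/-- Coordinates of `v - (0, d)`. [folklore] -/
@[simp] theorem sub_vec_apply_one (v : Site 2) (c : ℤ) : (v - ![0, c]) 1 = v 1 - c := by simp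

/-- Coordinates of `v + (0, d)`. [folklore] -/
@[simp] theorem add_vec_apply_zero (v : Site 2) (c : ℤ) : (v + ![0, c]) 0 = v 0 := by simp

/-- Coordinates of `v + (0, d)`. [folklore] -/
@[simp] theorem add_vec_apply_one (v : Site 2) (c : ℤ) : (v + ![0, c]) 1 = v 1 + c := by simp

/-- **(M1) Explored faces.** A face explored from below in `[0, n]²` (dual-joined to the bottom
row inside the dual square) at row `≥ d - 1` is, translated by `-(0, d)`, explored from below in
`[0, n]²` for `shiftDown d ω`: cut the dual-open path from the bottom row at its last visit to
row `d - 1`. [folklore] -/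
theorem sub_mem_dualBelow_shiftDown {f : Site 2} (hf : f ∈ dualBelow n ω) (hfd : (d : ℤ) - 1 ≤ f 1) :
    f - ![0, (d : ℤ)] ∈ dualBelow n (shiftDown d ω) := by
  classical
  obtain ⟨hfR, b, hb, hconn⟩ := mem_dualBelow_iff.1 hf
  obtain ⟨W, hWS, hWω⟩ := exists_walk_of_mem_openConnIn
    (fun _ h => h.1 : dualConfig ω ⊆ (zdGraph 2).edgeSet) hconn
  have hb1 : b 1 = -1 := (Finset.mem_filter.1 hb).2
  have hvis : ∃ z ∈ W.reverse.support, z ∈ {z : Site 2 | z 1 = (d : ℤ) - 1} := by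
    obtain ⟨z, hz, hz1⟩ := exists_mem_support_apply_eq W 1 ((d : ℤ) - 1) (by rw [hb1]; omega) hfd
    exact ⟨z, by rw [Walk.support_reverse, List.mem_reverse]; exact hz, hz1⟩
  obtain ⟨v, hv, q, hqs, hqe, hqd⟩ := exists_prefix_first_mem W.reverse hvis
  have hv1 : v 1 = (d : ℤ) - 1 := hv
  have hqge : ∀ z ∈ q.support, (d : ℤ) - 1 ≤ z 1 :=
    apply_ge_of_darts'' q 1 _ hfd fun e he => hqd e he
  have hqR : ∀ z ∈ q.support, z ∈ dualRectangle n n := fun z hz => by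
    have h' := hqs z hz
    rw [Walk.support_reverse, List.mem_reverse] at h'
    exact Finset.mem_coe.1 (hWS z h')
  have hqω : ∀ e ∈ q.edges, e ∈ dualConfig ω := fun e he => by
    have h' := hqe e he
    rw [Walk.edges_reverse, List.mem_reverse] at h'
    exact hWω e h'
  have hxu : ∀ x : Site 2, x + -![0, (d : ℤ)] = x - ![0, (d : ℤ)] := fun x => by rw [← sub_eq_add_neg]
  -- the translated prefix, reversed: from `v - (0,d)` (bottom row) to `f - (0,d)`
  have hS : ∀ z ∈ (q.map (zdShiftIso (-![0, (d : ℤ)])).toHom).support,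
      z ∈ (↑(dualRectangle n n) : Set (Site 2)) := by
    intro z hz
    rw [Walk.support_map, List.mem_map] at hz
    obtain ⟨w, hw, rfl⟩ := hz
    have hwR := hqR w hw
    have hwge := hqge w hw
    show w + -![0, (d : ℤ)] ∈ (↑(dualRectangle n n) : Set (Site 2))
    rw [mem_dualRectangle_iff] at hwR
    rw [Finset.mem_coe, mem_dualRectangle_iff, hxu, sub_vec_apply_zero, sub_vec_apply_one]
    omega
  have hE : ∀ e ∈ (q.map (zdShiftIso (-![0, (d : ℤ)])).toHom).edges, e ∈ dualConfig (shiftDown d ω) := by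
    intro e he
    rw [Walk.edges_map, List.mem_map] at he
    obtain ⟨e₀, he₀, rfl⟩ := he
    show Sym2.map (Site.shift (-![0, (d : ℤ)])) e₀ ∈ dualConfig (shiftDown d ω)
    rw [map_shift_mem_dualConfig_shiftDown_iff]
    exact hqω e₀ he₀
  have key := mem_openConnIn_of_walk _ hS hE
  change dualConfig (shiftDown d ω) ∈
    openConnIn (↑(dualRectangle n n) : Set (Site 2)) (f + -![0, (d : ℤ)]) (v + -![0, (d : ℤ)]) at key
  rw [hxu, hxu] at key
  have hvR := hqR v q.end_mem_support
  rw [mem_dualRectangle_iff] at hvR hfR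
  refine mem_dualBelow_iff.2 ⟨?_, v - ![0, (d : ℤ)], ?_, by rw [openConnIn_comm]; exact key⟩
  · rw [mem_dualRectangle_iff, sub_vec_apply_zero, sub_vec_apply_one]
    omega
  · rw [dualBottomSide, Finset.mem_filter, mem_dualRectangle_iff, sub_vec_apply_zero,
      sub_vec_apply_one]
    omega

/-- **(M2) Hull faces.** A lower-hull face of `[0, n]²` at row `≥ d - 1` is, translated by
`-(0, d)`, a lower-hull face of `[0, n]²` for `shiftDown d ω`: a face path from the top row
freeing the translated face would, translated back and cut at its last visit to row `n`, free the
face (it avoids the explored faces by (M1)). [folklore] -/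
theorem sub_mem_lowerHull_shiftDown {f : Site 2} (hf : f ∈ lowerHull n ω) (hfd : (d : ℤ) - 1 ≤ f 1) :
    f - ![0, (d : ℤ)] ∈ lowerHull n (shiftDown d ω) := by
  classical
  obtain ⟨hfR, hnot⟩ := (mem_lowerHull_iff n).1 hf
  rw [mem_dualRectangle_iff] at hfR
  refine (mem_lowerHull_iff n).2 ⟨?_, fun hfree => hnot ?_⟩
  · rw [mem_dualRectangle_iff, sub_vec_apply_zero, sub_vec_apply_one]
    omega
  obtain ⟨t, ht, f', hf', hconn⟩ := hfree
  rw [Set.mem_singleton_iff] at hf'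
  subst hf'
  have ht1 : t 1 = n := (Finset.mem_filter.1 ht).2
  obtain ⟨W, hWS, -⟩ := exists_walk_of_mem_openConnIn (fun _ h => h) hconn
  -- reverse (from `f - (0,d)` to `t`) and cut at the first visit to row `n - d`
  have hvis : ∃ z ∈ W.reverse.support, z ∈ {z : Site 2 | z 1 = (n : ℤ) - d} := by
    obtain ⟨z, hz, hz1⟩ := exists_mem_support_apply_eq W.reverse 1 ((n : ℤ) - d)
      (by rw [sub_vec_apply_one]; omega) (by rw [ht1]; omega)
    exact ⟨z, hz, hz1⟩
  obtain ⟨u, hu, q, hqs, -, hqd⟩ := exists_prefix_first_mem W.reverse hvis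
  have hu1 : u 1 = (n : ℤ) - d := hu
  have hqle : ∀ z ∈ q.support, z 1 ≤ (n : ℤ) - d :=
    apply_le_of_darts q 1 _ (by rw [sub_vec_apply_one]; omega) fun e he => hqd e he
  have hqS : ∀ z ∈ q.support, z ∈ dualRectangle n n ∧ z ∉ dualBelow n (shiftDown d ω) := fun z hz => by
    have h' := hqs z hz
    rw [Walk.support_reverse, List.mem_reverse] at h'
    have h'' := hWS z h'
    exact ⟨Finset.mem_coe.1 h''.1, fun hz' => h''.2 (Finset.mem_coe.2 hz')⟩
  -- translate by `+(0, d)`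
  have hS : ∀ z ∈ (q.map (zdShiftIso ![0, (d : ℤ)]).toHom).support,
      z ∈ (↑(dualRectangle n n) : Set (Site 2)) \ ↑(dualBelow n ω) := by
    intro z hz
    rw [Walk.support_map, List.mem_map] at hz
    obtain ⟨w, hw, rfl⟩ := hz
    obtain ⟨hwR, hwD⟩ := hqS w hw
    have hwle := hqle w hw
    rw [mem_dualRectangle_iff] at hwR
    show w + ![0, (d : ℤ)] ∈ (↑(dualRectangle n n) : Set (Site 2)) \ ↑(dualBelow n ω)
    refine ⟨?_, fun hwD' => hwD ?_⟩
    · rw [Finset.mem_coe, mem_dualRectangle_iff, add_vec_apply_zero, add_vec_apply_one]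
      omega
    · have := sub_mem_dualBelow_shiftDown (d := d) (Finset.mem_coe.1 hwD') (by rw [add_vec_apply_one]; omega)
      rwa [add_sub_cancel_right] at this
  have key := mem_openConnIn_of_walk (ω := (zdGraph 2).edgeSet) _ hS fun e he => Walk.edges_subset_edgeSet _ he
  change (zdGraph 2).edgeSet ∈ openConnIn ((↑(dualRectangle n n) : Set (Site 2)) \ ↑(dualBelow n ω))
      (f - ![0, (d : ℤ)] + ![0, (d : ℤ)]) (u + ![0, (d : ℤ)]) at key
  rw [sub_add_cancel] at key
  have huR := (hqS u q.end_mem_support).1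
  rw [mem_dualRectangle_iff] at huR
  refine ⟨u + ![0, (d : ℤ)], ?_, f, rfl, by rw [openConnIn_comm]; exact key⟩
  rw [Finset.mem_coe, dualTopSide, Finset.mem_filter, mem_dualRectangle_iff, add_vec_apply_zero,
    add_vec_apply_one]
  omega

/-- The faces around `v`, translated. [folklore] -/
theorem sub_mem_facesAt_sub {v g : Site 2} (h : g ∈ facesAt v) (x : Site 2) : g - x ∈ facesAt (v - x) := by
  rw [mem_facesAt_iff] at h ⊢
  rcases h with rfl | rfl | rfl | rfl
  · exact Or.inl rfl
  · exact Or.inr (Or.inl (by abel))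
  · exact Or.inr (Or.inr (Or.inl (by abel)))
  · exact Or.inr (Or.inr (Or.inr (by abel)))

/-- A face around `v` has row `v₁` or `v₁ - 1`. [folklore] -/
theorem apply_one_le_of_mem_facesAt {v g : Site 2} (h : g ∈ facesAt v) : v 1 ≤ g 1 + 1 ∧ g 1 ≤ v 1 := by
  rw [mem_facesAt_iff] at h
  rcases h with rfl | rfl | rfl | rfl <;> simp

/-- **(M3) Regions — monotonicity of B–R's region `A` in the height of the square.** A point of
the lower region of `[0, n]²` ("on or below `LH([0,n]²)`") is, translated by `-(0, d)`, a point
of the lower region of `[0, n]²` for `shiftDown d ω`; in absolute coordinates: the region on or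
below the lowest crossing of `[0,n] × [h, h+n]` lies in the region on or below the lowest crossing
of `[0,n] × [h', h'+n]` for `h ≤ h'`. [cite: BollobasRiordan2010, §5.1 Lemma 5.6] -/
theorem sub_mem_lowerRegion_shiftDown {v : Site 2} (hv : v ∈ lowerRegion n ω) :
    v - ![0, (d : ℤ)] ∈ lowerRegion n (shiftDown d ω) := by
  rw [mem_lowerRegion_iff] at hv ⊢
  rcases hv with hv | ⟨g, hg, hgH⟩
  · left
    rw [sub_vec_apply_one]
    omega
  · by_cases hgd : (d : ℤ) - 1 ≤ g 1
    · exact Or.inr ⟨g - ![0, (d : ℤ)], sub_mem_facesAt_sub hg _, sub_mem_lowerHull_shiftDown hgH hgd⟩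
    · left
      have := (apply_one_le_of_mem_facesAt hg).1
      rw [sub_vec_apply_one]
      omega

end Monotone

/-! ### Registered glue -/

/-- Statement form of `sub_mem_lowerRegion_shiftDown` (monotonicity of the lower region in the
height of the square): a registered glue step the LINE POSITS and proves right below
(`lowerRegionMono_holds`); not a literature fact, never to be relocated. -/
def LowerRegionMonoStatement : Prop :=
  ∀ (n d : ℕ) (ω : BondConfig (Site 2)) (v : Site 2), v ∈ lowerRegion n ω →
    v - ![0, (d : ℤ)] ∈ lowerRegion n (shiftDown d ω)

/-- Monotonicity of the lower region in the height of the square. [cite: BollobasRiordan2010, §5.1 Lemma 5.6] -/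
theorem lowerRegionMono_holds : LowerRegionMonoStatement := fun _ _ _ _ h => sub_mem_lowerRegion_shiftDown h

end Summit.CriticalPhenomena.CardyFormulaZ2.Cruxes.UniformBoxCrossing.NonSlantLine
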